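import Mathlib
import Summits.AtomisticToContinuum.Crystallization.Theses.PoissonBesselStacking
import Literature.MathematicalPhysics.StatisticalMechanics.HaggStacking

/-!
# Route PricedLinkCensus — Hägg domination at all ranges (`StackingHinge`, line Sketch)
(stub `stub_haggDominationAllRanges` of line Sketch, stmt-AtomisticToContinuum-14993; the statement
is item stmt-AtomisticToContinuum-0737 `PoissonBesselStacking.HaggDominationAllRanges` by name)

For couplings `J : ℕ → ℝ` with `Σ k|J_k| < ∞` and the domination hypothesis
`J₂ + Σ_{k ≥ 3} (k − 1)|J_k| ≤ 0`, every `±1` sequence `s` and every `n` satisfy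
`n · Σ_{k ≥ 2 even} J_k ≤ H_n(J, s) + Σ_k k|J_k|`, where
`H_n(J, s) = Σ_{m < n} Σ'_{k ≥ 2} J_k · 1[s_m + ⋯ + s_{m+k-1} ≡ 0 (mod 3)]`.

Proof (Peierls count).  Let `b = #{m < n : s (m+1) = s m}` be the number of bad bonds in `[0, n)`.
* `k = 2`: a window of length two is aligned iff its bond is good, so exactly `n − b` windows
  `m < n` are aligned (`count_two`) and the `k = 2` column of `H_n` is `J₂ (n − b)`.
* `k ≥ 3`: a window all of whose internal bonds are good alternates, so its sum is `0` for even `k`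
  and `±1` for odd `k` (`window_alt`): it is aligned iff `k` is even.  The windows `m < n` having a
  bad internal bond `j` are covered by `k − 1` translates of the bad bonds `j < n` together with the
  `≤ k − 2` windows reaching beyond `n` (`card_le_of_bad`), so the number `A_k` of aligned windows
  satisfies `n − (k−1)(b+1) ≤ A_k ≤ n` for even `k` and `A_k ≤ (k−1)(b+1)` for odd `k`
  (`count_even`, `count_odd`).
* Hence termwise `n · J_k [k even] ≤ Σ_{m<n} J_k 1[aligned] + X_k` with `X_2 = J₂ b` and
  `X_k = (b+1)(k−1)|J_k|` for `k ≥ 3` (`key`); summing over `k` (all series are dominated by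
  `Σ k|J_k|`) gives `n Σ_{even} J_k ≤ H_n + J₂ b + (b+1) Σ_{k≥3}(k−1)|J_k|
  = H_n + b (J₂ + Σ_{k≥3}(k−1)|J_k|) + Σ_{k≥3}(k−1)|J_k| ≤ H_n + 0 + Σ_k k|J_k|` (`assemble`).

All `[folklore]`.
-/

namespace Summit.AtomisticToContinuum.Crystallization.Theorems.PricedHcpWindowsHaggDomination

open Finset

/-! ### Alternating stretches of a `±1` sequence -/

/-- Along a stretch without bad bonds a `±1` sequence alternates: `s (m + i) = (−1)^i s m`.
[folklore] -/
theorem alt_values {s : ℤ → ℤ} (hs : ∀ i, s i = 1 ∨ s i = -1) (m : ℤ) (K : ℕ)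
    (h : ∀ j : ℕ, j < K → s (m + j + 1) ≠ s (m + j)) :
    ∀ i : ℕ, i ≤ K → s (m + i) = if Even i then s m else -s m := by
  intro i
  induction i with
  | zero => intro; simp
  | succ i ih =>
    intro hi
    have hprev := ih (by omega)
    have hne := h i (by omega)
    have hstep : s (m + i + 1) = -s (m + i) := by
      rcases hs (m + i + 1) with h1 | h1 <;> rcases hs (m + i) with h2 | h2 <;> omega
    have hcast : (m + ((i + 1 : ℕ) : ℤ)) = m + i + 1 := by push_cast; ring
    rw [hcast, hstep, hprev]
    by_cases hi2 : Even i
    · have : ¬ Even (i + 1) := by simpa [Nat.even_add_one] using hi2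
      simp [hi2, this]
    · have : Even (i + 1) := by simpa [Nat.even_add_one] using hi2
      simp [hi2, this]

/-- The window sum over a stretch without bad bonds: `0` for even length, `s m` for odd length.
[folklore] -/
theorem window_alt {s : ℤ → ℤ} (hs : ∀ i, s i = 1 ∨ s i = -1) (m : ℤ) :
    ∀ k : ℕ, (∀ j : ℕ, j + 2 ≤ k → s (m + j + 1) ≠ s (m + j)) →
      ∑ i ∈ range k, s (m + i) = if Even k then 0 else s m := by
  intro k
  induction k with
  | zero => intro; simp
  | succ k ih =>
    intro h
    have hk := ih (fun j hj => h j (by omega))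
    have hval : s (m + k) = if Even k then s m else -s m :=
      alt_values hs m k (fun j hj => h j (by omega)) k le_rfl
    rw [sum_range_succ, hk, hval]
    by_cases hk2 : Even k
    · have : ¬ Even (k + 1) := by simpa [Nat.even_add_one] using hk2
      simp [hk2, this]
    · have : Even (k + 1) := by simpa [Nat.even_add_one] using hk2
      simp [hk2, this]

/-- A window of a `±1` sequence which is NOT "aligned iff of even length" contains a bad bond.
[folklore] -/
theorem exists_bad_of_not_iff {s : ℤ → ℤ} (hs : ∀ i, s i = 1 ∨ s i = -1) (m : ℤ) (k : ℕ)
    (h : ¬ ((∑ i ∈ range k, s (m + i)) % 3 = 0 ↔ Even k)) :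
    ∃ j : ℕ, j + 2 ≤ k ∧ s (m + j + 1) = s (m + j) := by
  by_contra hne
  push Not at hne
  apply h
  rw [window_alt hs m k hne]
  by_cases hk : Even k
  · simp [hk]
  · simp only [hk, if_false, iff_false]
    rcases hs m with h1 | h1 <;> rw [h1] <;> decide

/-! ### The Peierls covering count -/

/-- If every `m ∈ T ⊆ [0, n)` has a bad bond `j ∈ [m, m + k − 2]`, then
`#T ≤ (k − 1)(b + 1)`, `b` the number of bad bonds in `[0, n)`: such `m` lie in the `k − 1`
left-translates of the bad bonds `j < n` or among the last `k − 2` sites of `[0, n)`. [folklore] -/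
theorem card_le_of_bad (s : ℤ → ℤ) (n k : ℕ) (hk : 2 ≤ k) (T : Finset ℕ) (hT : T ⊆ range n)
    (hnc : ∀ m ∈ T, ∃ j : ℕ, m ≤ j ∧ j + 2 ≤ m + k ∧ s ((j : ℤ) + 1) = s j) :
    T.card ≤ (k - 1) * (((range n).filter (fun m : ℕ => s ((m : ℤ) + 1) = s m)).card + 1) := by
  set B := (range n).filter (fun m : ℕ => s ((m : ℤ) + 1) = s m) with hB
  have hsub : T ⊆ (B.biUnion fun j => Ico (j + 2 - k) (j + 1)) ∪ Ico (n + 2 - k) n := by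
    intro m hm
    have hmn : m < n := mem_range.1 (hT hm)
    obtain ⟨j, hmj, hjk, hbad⟩ := hnc m hm
    rw [mem_union]
    by_cases hjn : j < n
    · left
      rw [mem_biUnion]
      refine ⟨j, ?_, ?_⟩
      · rw [hB, mem_filter]
        exact ⟨mem_range.2 hjn, hbad⟩
      · rw [mem_Ico]
        omega
    · right
      rw [mem_Ico]
      omega
  have h1 : (B.biUnion fun j => Ico (j + 2 - k) (j + 1)).card ≤ B.card * (k - 1) :=
    card_biUnion_le_card_mul B _ (k - 1) (fun j _ => by simp only [Nat.card_Ico]; omega)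
  have h2 : (Ico (n + 2 - k) n).card ≤ k - 1 := by simp only [Nat.card_Ico]; omega
  calc T.card ≤ ((B.biUnion fun j => Ico (j + 2 - k) (j + 1)) ∪ Ico (n + 2 - k) n).card :=
        card_le_card hsub
    _ ≤ (B.biUnion fun j => Ico (j + 2 - k) (j + 1)).card + (Ico (n + 2 - k) n).card :=
        card_union_le _ _
    _ ≤ B.card * (k - 1) + (k - 1) := add_le_add h1 h2
    _ = (k - 1) * (B.card + 1) := by ring

/-- Even `k ≥ 2`: at least `n − (k−1)(b+1)` of the windows `m < n` of length `k` are aligned.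
[folklore] -/
theorem count_even {s : ℤ → ℤ} (hs : ∀ i, s i = 1 ∨ s i = -1) (n k : ℕ) (hk : 2 ≤ k)
    (he : Even k) :
    n ≤ ((range n).filter (fun m : ℕ => (∑ i ∈ range k, s ((m : ℤ) + i)) % 3 = 0)).card +
      (k - 1) * (((range n).filter (fun m : ℕ => s ((m : ℤ) + 1) = s m)).card + 1) := by
  have hT := card_le_of_bad s n k hk
    ((range n).filter (fun m : ℕ => ¬ (∑ i ∈ range k, s ((m : ℤ) + i)) % 3 = 0))
    (filter_subset _ _) (by
      intro m hm
      rw [mem_filter] at hm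
      obtain ⟨j, hj, hbad⟩ :=
        exists_bad_of_not_iff hs (m : ℤ) k (fun hiff => hm.2 (hiff.2 he))
      exact ⟨m + j, by omega, by omega, by push_cast; exact hbad⟩)
  have hsplit := card_filter_add_card_filter_not (s := range n)
    (fun m : ℕ => (∑ i ∈ range k, s ((m : ℤ) + i)) % 3 = 0)
  rw [card_range] at hsplit
  omega

/-- Odd `k ≥ 2`: at most `(k−1)(b+1)` of the windows `m < n` of length `k` are aligned.
[folklore] -/
theorem count_odd {s : ℤ → ℤ} (hs : ∀ i, s i = 1 ∨ s i = -1) (n k : ℕ) (hk : 2 ≤ k)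
    (ho : ¬ Even k) :
    ((range n).filter (fun m : ℕ => (∑ i ∈ range k, s ((m : ℤ) + i)) % 3 = 0)).card ≤
      (k - 1) * (((range n).filter (fun m : ℕ => s ((m : ℤ) + 1) = s m)).card + 1) :=
  card_le_of_bad s n k hk _ (filter_subset _ _) (by
    intro m hm
    rw [mem_filter] at hm
    obtain ⟨j, hj, hbad⟩ :=
      exists_bad_of_not_iff hs (m : ℤ) k (fun hiff => ho (hiff.1 hm.2))
    exact ⟨m + j, by omega, by omega, by push_cast; exact hbad⟩)

/-- `k = 2`: a window of length two is aligned iff its bond is good, so the aligned windows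
`m < n` and the bad bonds in `[0, n)` together number exactly `n`. [folklore] -/
theorem count_two {s : ℤ → ℤ} (hs : ∀ i, s i = 1 ∨ s i = -1) (n : ℕ) :
    ((range n).filter (fun m : ℕ => (∑ i ∈ range 2, s ((m : ℤ) + i)) % 3 = 0)).card +
      ((range n).filter (fun m : ℕ => s ((m : ℤ) + 1) = s m)).card = n := by
  have hcongr : (range n).filter (fun m : ℕ => (∑ i ∈ range 2, s ((m : ℤ) + i)) % 3 = 0) =
      (range n).filter (fun m : ℕ => ¬ s ((m : ℤ) + 1) = s m) := by
    refine filter_congr (fun m _ => ?_)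
    simp only [sum_range_succ, sum_range_zero, Nat.cast_zero, add_zero, Nat.cast_one, zero_add]
    rcases hs m with h1 | h1 <;> rcases hs ((m : ℤ) + 1) with h2 | h2 <;> omega
  rw [hcongr, add_comm]
  have := card_filter_add_card_filter_not (s := range n) (fun m : ℕ => s ((m : ℤ) + 1) = s m)
  rwa [card_range] at this

/-! ### The termwise inequality -/

/-- The Peierls estimate column by column: for every `k`,
`n · J_k [2 ≤ k even] ≤ Σ_{m<n} J_k 1[window (m,k) aligned] + X_k`, where `X_2 = J₂ · b`,
`X_k = (b + 1)(k − 1)|J_k|` for `k ≥ 3` and `X_k = 0` for `k ≤ 1`. [folklore] -/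
theorem key {s : ℤ → ℤ} (hs : ∀ i, s i = 1 ∨ s i = -1) (J : ℕ → ℝ) (n k : ℕ) :
    (n : ℝ) * (if 2 ≤ k ∧ Even k then J k else 0) ≤
      (∑ m ∈ range n, (if 2 ≤ k ∧ (∑ i ∈ range k, s ((m : ℤ) + i)) % 3 = 0 then J k else 0)) +
      ((if k = 2 then J 2 * (((range n).filter (fun m : ℕ => s ((m : ℤ) + 1) = s m)).card : ℝ)
          else 0) +
        ((((range n).filter (fun m : ℕ => s ((m : ℤ) + 1) = s m)).card : ℝ) + 1) *
          (if 3 ≤ k then ((k : ℝ) - 1) * |J k| else 0)) := by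
  set b := ((range n).filter (fun m : ℕ => s ((m : ℤ) + 1) = s m)).card with hb
  rcases lt_or_ge k 2 with hk | hk
  · have h2 : ¬ (2 ≤ k) := by omega
    have h3 : ¬ (3 ≤ k) := by omega
    have h4 : k ≠ 2 := by omega
    simp [h2, h3, h4]
  set A := ((range n).filter (fun m : ℕ => (∑ i ∈ range k, s ((m : ℤ) + i)) % 3 = 0)).card
    with hA
  have hsumA : ∑ m ∈ range n,
      (if 2 ≤ k ∧ (∑ i ∈ range k, s ((m : ℤ) + i)) % 3 = 0 then J k else 0) = (A : ℝ) * J k := by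
    rw [hA, ← nsmul_eq_mul, ← sum_const, sum_filter]
    exact sum_congr rfl (fun m _ => by simp [hk])
  rw [hsumA]
  rcases hk.eq_or_lt with hk2 | hk3
  · -- `k = 2`: exact count
    subst hk2
    have hcnt : A + b = n := count_two hs n
    have hcast : (n : ℝ) = A + b := by exact_mod_cast hcnt.symm
    have e1 : (if 2 ≤ 2 ∧ Even 2 then J 2 else 0) = J 2 := by simp
    have e2 : (if (2 : ℕ) = 2 then J 2 * (b : ℝ) else 0) = J 2 * b := by simp
    have e3 : (if 3 ≤ 2 then (((2 : ℕ) : ℝ) - 1) * |J 2| else 0) = 0 := by simp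
    rw [e1, e2, e3, hcast]
    nlinarith
  · -- `k ≥ 3`
    have h3 : 3 ≤ k := hk3
    have hk2 : k ≠ 2 := by omega
    have hcastk : (((k - 1 : ℕ)) : ℝ) = (k : ℝ) - 1 := by
      rw [Nat.cast_sub (by omega : 1 ≤ k)]; simp
    have e2 : (if k = 2 then J 2 * (b : ℝ) else 0) = 0 := by simp [hk2]
    have e3 : (if 3 ≤ k then ((k : ℝ) - 1) * |J k| else 0) = ((k : ℝ) - 1) * |J k| := by simp [h3]
    rw [e2, e3, zero_add]
    by_cases he : Even k
    · have hcnt := count_even hs n k hk he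
      have hAn : A ≤ n := (card_filter_le _ _).trans (card_range n).le
      have hcnt' : (n : ℝ) - A ≤ ((k : ℝ) - 1) * ((b : ℝ) + 1) := by
        have : ((n : ℕ) : ℝ) ≤ ((A + (k - 1) * (b + 1) : ℕ) : ℝ) := by exact_mod_cast hcnt
        rw [Nat.cast_add, Nat.cast_mul, hcastk, Nat.cast_add, Nat.cast_one] at this
        linarith
      have hAn' : (A : ℝ) ≤ n := by exact_mod_cast hAn
      have e1 : (if 2 ≤ k ∧ Even k then J k else 0) = J k := by simp [hk, he]
      rw [e1]
      have h1 : ((n : ℝ) - A) * J k ≤ ((n : ℝ) - A) * |J k| :=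
        mul_le_mul_of_nonneg_left (le_abs_self _) (sub_nonneg.2 hAn')
      have h2 : ((n : ℝ) - A) * |J k| ≤ ((k : ℝ) - 1) * ((b : ℝ) + 1) * |J k| :=
        mul_le_mul_of_nonneg_right hcnt' (abs_nonneg _)
      linarith
    · have hcnt := count_odd hs n k hk he
      have hcnt' : (A : ℝ) ≤ ((k : ℝ) - 1) * ((b : ℝ) + 1) := by
        have : ((A : ℕ) : ℝ) ≤ (((k - 1) * (b + 1) : ℕ) : ℝ) := by exact_mod_cast hcnt
        rw [Nat.cast_mul, hcastk, Nat.cast_add, Nat.cast_one] at this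
        exact this
      have hA0 : (0 : ℝ) ≤ A := Nat.cast_nonneg _
      have e1 : (if 2 ≤ k ∧ Even k then J k else 0) = 0 := by simp [he]
      rw [e1]
      have h1 : (A : ℝ) * (-J k) ≤ (A : ℝ) * |J k| :=
        mul_le_mul_of_nonneg_left (neg_le_abs _) hA0
      have h2 : (A : ℝ) * |J k| ≤ ((k : ℝ) - 1) * ((b : ℝ) + 1) * |J k| :=
        mul_le_mul_of_nonneg_right hcnt' (abs_nonneg _)
      linarith

/-! ### Summation over all ranges -/

/-- The domination inequality, with the three series named (`g`: the even couplings, `e`: the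
domination weights `(k−1)|J_k|`, `f m`: the column of `H_n` at layer `m`). [folklore] -/
theorem assemble (J : ℕ → ℝ) (s : ℤ → ℤ) (n : ℕ) (hs : ∀ i, s i = 1 ∨ s i = -1)
    (hsum : Summable (fun k : ℕ => (k : ℝ) * |J k|))
    (g : ℕ → ℝ) (hg : g = fun k : ℕ => if 2 ≤ k ∧ Even k then J k else 0)
    (e : ℕ → ℝ) (he : e = fun k : ℕ => if 3 ≤ k then ((k : ℝ) - 1) * |J k| else 0)
    (f : ℕ → ℕ → ℝ)
    (hf : f = fun (m : ℕ) (k : ℕ) =>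
      if 2 ≤ k ∧ (∑ i ∈ range k, s ((m : ℤ) + i)) % 3 = 0 then J k else 0)
    (hdom : J 2 + ∑' k, e k ≤ 0) :
    (n : ℝ) * ∑' k, g k ≤ (∑ m ∈ range n, ∑' k, f m k) + ∑' k : ℕ, (k : ℝ) * |J k| := by
  obtain ⟨b, hb⟩ : ∃ b : ℕ, b = ((range n).filter (fun m : ℕ => s ((m : ℤ) + 1) = s m)).card :=
    ⟨_, rfl⟩
  obtain ⟨X, hX⟩ : ∃ X : ℕ → ℝ,
      X = fun k : ℕ => (if k = 2 then J 2 * (b : ℝ) else 0) + ((b : ℝ) + 1) * e k := ⟨_, rfl⟩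
  -- one `|J k|` is dominated by `k |J k|` as soon as the guard `2 ≤ k` holds
  have hJle : ∀ k : ℕ, 2 ≤ k → |J k| ≤ (k : ℝ) * |J k| := fun k hk =>
    le_mul_of_one_le_left (abs_nonneg _) (by exact_mod_cast (show 1 ≤ k by omega))
  have hg_sum : Summable g := by
    refine Summable.of_norm_bounded hsum (fun k => ?_)
    simp only [hg, Real.norm_eq_abs]
    split_ifs with h
    · exact hJle k h.1
    · rw [abs_zero]; positivity
  have hf_sum : ∀ m : ℕ, Summable (f m) := by
    intro m
    refine Summable.of_norm_bounded hsum (fun k => ?_)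
    simp only [hf, Real.norm_eq_abs]
    split_ifs with h
    · exact hJle k h.1
    · rw [abs_zero]; positivity
  have he_le : ∀ k, e k ≤ (k : ℝ) * |J k| := by
    intro k
    simp only [he]
    split_ifs with h
    · nlinarith [abs_nonneg (J k)]
    · positivity
  have he_nonneg : ∀ k, 0 ≤ e k := by
    intro k
    simp only [he]
    split_ifs with h
    · have : (1 : ℝ) ≤ k := by exact_mod_cast (show 1 ≤ k by omega)
      nlinarith [abs_nonneg (J k)]
    · exact le_rfl
  have he_sum : Summable e := Summable.of_nonneg_of_le he_nonneg he_le hsum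
  have hind_sum : Summable (fun k : ℕ => if k = 2 then J 2 * (b : ℝ) else 0) :=
    (hasSum_ite_eq 2 (J 2 * (b : ℝ))).summable
  have hX_sum : Summable X := by rw [hX]; exact hind_sum.add (he_sum.mul_left _)
  have hF_sum : Summable (fun k => ∑ m ∈ range n, f m k) := summable_sum (fun m _ => hf_sum m)
  -- termwise Peierls inequality
  have key' : ∀ k, (n : ℝ) * g k ≤ (∑ m ∈ range n, f m k) + X k := by
    intro k
    have h := key hs J n k
    rw [← hb] at h
    rw [hg, hf, hX, he]
    exact h
  -- summing over `k`
  have h1 : ∑' k, (n : ℝ) * g k ≤ ∑' k, ((∑ m ∈ range n, f m k) + X k) :=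
    Summable.tsum_le_tsum key' (hg_sum.mul_left _) (hF_sum.add hX_sum)
  have h2 : ∑' k, ((∑ m ∈ range n, f m k) + X k) =
      (∑ m ∈ range n, ∑' k, f m k) + ∑' k, X k := by
    rw [Summable.tsum_add hF_sum hX_sum, Summable.tsum_finsetSum (fun m _ => hf_sum m)]
  have h3 : ∑' k, X k = J 2 * (b : ℝ) + ((b : ℝ) + 1) * ∑' k, e k := by
    rw [hX]
    rw [Summable.tsum_add hind_sum (he_sum.mul_left _), tsum_ite_eq, tsum_mul_left]
  have h4 : ∑' k, e k ≤ ∑' k : ℕ, (k : ℝ) * |J k| := Summable.tsum_le_tsum he_le he_sum hsum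
  have h5 : (b : ℝ) * (J 2 + ∑' k, e k) ≤ 0 :=
    mul_nonpos_of_nonneg_of_nonpos (Nat.cast_nonneg b) hdom
  have h6 : ∑' k, X k ≤ ∑' k : ℕ, (k : ℝ) * |J k| := by
    rw [h3]
    rw [mul_add] at h5
    linarith
  calc (n : ℝ) * ∑' k, g k = ∑' k, (n : ℝ) * g k := tsum_mul_left.symm
    _ ≤ ∑' k, ((∑ m ∈ range n, f m k) + X k) := h1
    _ = (∑ m ∈ range n, ∑' k, f m k) + ∑' k, X k := h2
    _ ≤ (∑ m ∈ range n, ∑' k, f m k) + ∑' k : ℕ, (k : ℝ) * |J k| := by linarith [h6]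

/-- **Hägg domination, all ranges** (item stmt-AtomisticToContinuum-0737, route decl
`PoissonBesselStacking.HaggDominationAllRanges` by name): for `J` with `Σ k|J_k| < ∞` and
`J₂ + Σ_{k≥3}(k−1)|J_k| ≤ 0`, every `±1` sequence `s` and every `n`,
`n · Σ_{k ≥ 2 even} J_k ≤ H_n(J, s) + Σ_k k|J_k|`. [folklore] -/
theorem stub_haggDominationAllRanges : Summit.AtomisticToContinuum.Crystallization.Theses.PoissonBesselStacking.HaggDominationAllRanges := by
  intro J s n hs hsum hdom
  exact assemble J s n hs hsum _ rfl _ rfl _ rfl hdom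

end Summit.AtomisticToContinuum.Crystallization.Theorems.PricedHcpWindowsHaggDomination
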